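import Literature.Probability.LatticeModels.KCTouchReach
import HarnessLib

/-!
# The per-scale ends of the sign-condition contour: ℓ¹-nearest frozen sites and free cones

Topic `Literature/Probability/LatticeModels`. In the lattice sign-condition argument
(Chelkak–Smirnov 2012, proof of Thm. 6.1; `KCSignConditionLattice.lean`) the contour must END on
the frozen skeleton of the current lattice (the part of `∂Ω` invisible at mesh `δ` cannot carry
an end), along a straight lattice run whose lateral half-boxes of size `~ i/8` at distance `i`
from the end are free (hypotheses `hrunE`, `hconeE` of `kc_sign_condition_ineq`). This file
constructs such ends canonically from a point `z` of the free region: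

* `l1dist v z` — the `ℓ¹` distance from a site to a point; `exists_min_l1dist` — a frozen site
  `a*` minimising it exists (`Λ` finite); `mem_of_l1dist_lt` — every site strictly `ℓ¹`-closer
  to `z` than `a*` is free (the open `ℓ¹`-diamond about `z` through `a*` is free);
* `endRun_core` — the arithmetic heart: along the dominant axis from `a*` towards `z`, the sites
  within sup-distance `r` of the `i`-th plaquette of the run are `ℓ¹`-closer to `z` than `a*` as
  soon as `2r + 2 ≤ i` and `i + 1 ≤` the dominant distance;
* **`exists_endRun`** — the packaged end: a direction `k`, a plaquette `c₀ = faceAt a* j₁` having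
  `a*` as a corner, such that for `8 ≤ i`, `2 (i + 1) ≤ l1dist a* z`, every plaquette of the two
  lateral half-boxes `flatHalfBox (k ± 1) (runPt c₀ k i) (i/8) (i/8)` has all four corners free
  (so touches `Λ` across every side), and the centres of the run plaquettes `runPt c₀ k n` are
  within `ℓ¹`-distance `l1dist a* z - n` of `z` (so the inner part of the run lies in compact
  sub-diamonds).

All `[folklore]` lattice geometry; no named fact.

## References

* D. Chelkak, S. Smirnov, Invent. Math. 189 (2012) = arXiv:0910.2045, proof of Thm. 6.1 (the
  neighbourhoods of the ends `p^δ`, `s^δ`). [ChelkakSmirnov2012Ising]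
-/

noncomputable section

open Set

namespace Literature.Probability.LatticeModels

open Site WeakBeurling

/-! ### ℓ¹-nearest frozen sites -/

/-- The `ℓ¹` distance from the site `v` to the point `z`. [folklore] -/
def l1dist (v : Site 2) (z : ℂ) : ℝ := |(v 0 : ℝ) - z.re| + |(v 1 : ℝ) - z.im|

/-- `ℓ¹` distances are nonnegative. [folklore] -/
theorem l1dist_nonneg (v : Site 2) (z : ℂ) : 0 ≤ l1dist v z := by unfold l1dist; positivity

/-- Sites at bounded `ℓ¹` distance from `z` lie in a box. [folklore] -/
theorem finite_setOf_l1dist_le (z : ℂ) (m : ℝ) : {v : Site 2 | l1dist v z ≤ m}.Finite := by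
  have hsub : {v : Site 2 | l1dist v z ≤ m} ⊆
      Set.pi Set.univ (fun i : Fin 2 => Set.Icc (⌊(if i = 0 then z.re else z.im) - m⌋ - 1) (⌈(if i = 0 then z.re else z.im) + m⌉ + 1)) := by
    intro v hv
    simp only [Set.mem_setOf_eq, l1dist] at hv
    have h0 : |(v 0 : ℝ) - z.re| ≤ m := le_trans (le_add_of_nonneg_right (abs_nonneg _)) hv
    have h1 : |(v 1 : ℝ) - z.im| ≤ m := le_trans (le_add_of_nonneg_left (abs_nonneg _)) hv
    rw [abs_le] at h0 h1
    intro i _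
    fin_cases i
    · simp only [Fin.zero_eta, Fin.isValue, ↓reduceIte, Set.mem_Icc]
      constructor
      · have : (⌊z.re - m⌋ : ℝ) ≤ z.re - m := Int.floor_le _
        have : ((⌊z.re - m⌋ - 1 : ℤ) : ℝ) ≤ v 0 := by push_cast; linarith
        exact_mod_cast this
      · have : z.re + m ≤ (⌈z.re + m⌉ : ℝ) := Int.le_ceil _
        have : (v 0 : ℝ) ≤ ((⌈z.re + m⌉ + 1 : ℤ) : ℝ) := by push_cast; linarith
        exact_mod_cast this
    · simp only [Fin.mk_one, Fin.isValue, one_ne_zero, ↓reduceIte, Set.mem_Icc]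
      constructor
      · have : (⌊z.im - m⌋ : ℝ) ≤ z.im - m := Int.floor_le _
        have : ((⌊z.im - m⌋ - 1 : ℤ) : ℝ) ≤ v 1 := by push_cast; linarith
        exact_mod_cast this
      · have : z.im + m ≤ (⌈z.im + m⌉ : ℝ) := Int.le_ceil _
        have : (v 1 : ℝ) ≤ ((⌈z.im + m⌉ + 1 : ℤ) : ℝ) := by push_cast; linarith
        exact_mod_cast this
  exact (Set.Finite.pi fun i => Set.finite_Icc _ _).subset hsub

/-- **An `ℓ¹`-nearest frozen site exists** (the free set being finite). [folklore] -/
theorem exists_min_l1dist (Λ : Finset (Site 2)) (z : ℂ) :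
    ∃ a : Site 2, a ∉ Λ ∧ ∀ a' : Site 2, a' ∉ Λ → l1dist a z ≤ l1dist a' z := by
  classical
  obtain ⟨a₀, ha₀⟩ := Infinite.exists_notMem_finset Λ
  set S : Finset (Site 2) := ((finite_setOf_l1dist_le z (l1dist a₀ z)).toFinset).filter (· ∉ Λ) with hS
  have ha₀S : a₀ ∈ S := by
    rw [hS, Finset.mem_filter, Set.Finite.mem_toFinset]
    exact ⟨show l1dist a₀ z ≤ l1dist a₀ z from le_rfl, ha₀⟩
  obtain ⟨a, haS, hmin⟩ := S.exists_min_image (fun v => l1dist v z) ⟨a₀, ha₀S⟩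
  rw [hS, Finset.mem_filter, Set.Finite.mem_toFinset] at haS
  refine ⟨a, haS.2, fun a' ha' => ?_⟩
  by_cases h : l1dist a' z ≤ l1dist a₀ z
  · exact hmin a' (by rw [hS, Finset.mem_filter, Set.Finite.mem_toFinset]; exact ⟨show l1dist a' z ≤ l1dist a₀ z from h, ha'⟩)
  · push Not at h
    exact haS.1.trans h.le

/-- **The open `ℓ¹`-diamond through the nearest frozen site is free.** [folklore] -/
theorem mem_of_l1dist_lt {Λ : Finset (Site 2)} {z : ℂ} {a : Site 2}
    (hmin : ∀ a' : Site 2, a' ∉ Λ → l1dist a z ≤ l1dist a' z) {v : Site 2} (hv : l1dist v z < l1dist a z) : v ∈ Λ := by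
  by_contra h
  exact absurd (hmin v h) (not_le.2 hv)

/-! ### The arithmetic core -/

/-- The dominant coordinate of the `i`-th run plaquette (lower-left corner convention): from the
frozen coordinate `ax` towards `zx`. [folklore] -/
def endRunX (ax : ℤ) (zx : ℝ) (i : ℤ) : ℤ := if (ax : ℝ) < zx then ax + i else ax - 1 - i

/-- The lateral coordinate of the run plaquettes: the row on the side of `zy`. [folklore] -/
def endRunY (ay : ℤ) (zy : ℝ) : ℤ := if (ay : ℝ) ≤ zy then ay else ay - 1

/-- **The arithmetic core of the free cone.** If `i + 1 ≤ |ax - zx|` (guaranteed along the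
dominant axis while `2 (i + 1) ≤` the `ℓ¹` distance) and `2r + 2 ≤ i`, then every lattice point `(v₀, v₁)` with
`endRunX ax zx i - r ≤ v₀ ≤ endRunX ax zx i + r + 1` and `endRunY ay zy - r ≤ v₁ ≤ endRunY ay zy + r + 1`
is strictly `ℓ¹`-closer to `(zx, zy)` than `(ax, ay)`. [folklore] -/
theorem endRun_core {ax ay : ℤ} {zx zy : ℝ} {i r : ℕ}
    (hi : (i : ℝ) + 1 ≤ |(ax : ℝ) - zx|) (hr : 2 * r + 2 ≤ i) {v₀ v₁ : ℤ}
    (hv₀ : endRunX ax zx i - r ≤ v₀ ∧ v₀ ≤ endRunX ax zx i + r + 1)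
    (hv₁ : endRunY ay zy - r ≤ v₁ ∧ v₁ ≤ endRunY ay zy + r + 1) :
    |(v₀ : ℝ) - zx| + |(v₁ : ℝ) - zy| < |(ax : ℝ) - zx| + |(ay : ℝ) - zy| := by
  have hr' : (2 : ℝ) * r + 2 ≤ i := by exact_mod_cast hr
  -- the dominant coordinate gains `i - r`
  have hx : |(v₀ : ℝ) - zx| ≤ |(ax : ℝ) - zx| - i + r := by
    unfold endRunX at hv₀
    split_ifs at hv₀ with hlt
    · rw [abs_of_neg (sub_neg.2 hlt)] at hi ⊢
      have h1 : ((ax + i - r : ℤ) : ℝ) ≤ v₀ := by exact_mod_cast hv₀.1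
      have h2 : (v₀ : ℝ) ≤ ((ax + i + r + 1 : ℤ) : ℝ) := by exact_mod_cast hv₀.2
      push_cast at h1 h2
      rw [abs_le]; constructor <;> linarith
    · push Not at hlt
      have hpos : 0 ≤ (ax : ℝ) - zx := sub_nonneg.2 hlt
      rw [abs_of_nonneg hpos] at hi ⊢
      have h1 : ((ax - 1 - i - r : ℤ) : ℝ) ≤ v₀ := by exact_mod_cast hv₀.1
      have h2 : (v₀ : ℝ) ≤ ((ax - 1 - i + r + 1 : ℤ) : ℝ) := by exact_mod_cast hv₀.2
      push_cast at h1 h2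
      rw [abs_le]; constructor <;> linarith
  -- the lateral coordinate loses at most `r + 1`
  have hy : |(v₁ : ℝ) - zy| ≤ |(ay : ℝ) - zy| + r + 1 := by
    unfold endRunY at hv₁
    split_ifs at hv₁ with hle
    · rw [abs_of_nonpos (sub_nonpos.2 hle)]
      have h1 : ((ay - r : ℤ) : ℝ) ≤ v₁ := by exact_mod_cast hv₁.1
      have h2 : (v₁ : ℝ) ≤ ((ay + r + 1 : ℤ) : ℝ) := by exact_mod_cast hv₁.2
      push_cast at h1 h2
      rw [abs_le]; constructor <;> linarith
    · push Not at hle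
      rw [abs_of_pos (sub_pos.2 hle)]
      have h1 : ((ay - 1 - r : ℤ) : ℝ) ≤ v₁ := by exact_mod_cast hv₁.1
      have h2 : (v₁ : ℝ) ≤ ((ay - 1 + r + 1 : ℤ) : ℝ) := by exact_mod_cast hv₁.2
      push_cast at h1 h2
      rw [abs_le]; constructor <;> linarith
  linarith

/-! ### The packaged end run -/

/-- Coordinates of `faceAt`. [folklore] -/
theorem faceAt_apply (a : Site 2) (j : Fin 4) (l : Fin 2) : faceAt a j l = a l - cornerOff j l := by
  simp [faceAt]

/-- The plaquette with lower-left corner `(a 0 - ε₀, a 1 - ε₁)`, `εᵢ ∈ {0, 1}`, is a `faceAt a`. [folklore] -/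
theorem exists_faceAt_of_offsets (a c : Site 2) (h0 : c 0 = a 0 ∨ c 0 = a 0 - 1) (h1 : c 1 = a 1 ∨ c 1 = a 1 - 1) :
    ∃ j : Fin 4, c = faceAt a j := by
  rcases h0 with h0 | h0 <;> rcases h1 with h1 | h1
  · exact ⟨0, by ext l; fin_cases l <;> simp [faceAt_apply, h0, h1]⟩
  · exact ⟨3, by ext l; fin_cases l <;> simp [faceAt_apply, h0, h1]⟩
  · exact ⟨1, by ext l; fin_cases l <;> simp [faceAt_apply, h0, h1]⟩
  · exact ⟨2, by ext l; fin_cases l <;> simp [faceAt_apply, h0, h1]⟩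

/-- All four corners free forces touching across every side. [folklore] -/
theorem sideTouch_of_corners_mem {Λ : Finset (Site 2)} {f : Site 2} (h : ∀ i : Fin 4, f + cornerOff i ∈ Λ) (j : Fin 4) :
    SideTouch Λ f j := Or.inl (h j)

/-- The `ℓ¹` norm of a complex number (sum of the absolute values of its coordinates). [folklore] -/
def l1norm (w : ℂ) : ℝ := |w.re| + |w.im|

/-- **The packaged end run.** Let `a` be an `ℓ¹`-nearest frozen site to `z`. There are a run
direction `k` and a plaquette `c₀ = faceAt a j₁` (so `a` is a corner of `c₀`) such that:
(i) for `8 ≤ i` with `2 (i + 1) ≤ l1dist a z`, every plaquette of the two lateral half-boxes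
`flatHalfBox m (runPt c₀ k i) (i/8) (i/8)`, `m = k ± 1`, has its four corners free, hence touches
`Λ` across every side; (ii) for `n : ℕ` with `2 n + 1 ≤ l1dist a z`, the centre of the run
plaquette `runPt c₀ k n` is within `ℓ¹`-distance `l1dist a z - n` of `z`.
[cite: ChelkakSmirnov2012Ising, proof of Thm. 6.1 (neighbourhoods of the ends p^δ, s^δ)] -/
theorem exists_endRun (Λ : Finset (Site 2)) (z : ℂ) {a : Site 2}
    (hmin : ∀ a' : Site 2, a' ∉ Λ → l1dist a z ≤ l1dist a' z) :
    ∃ (k j₁ : Fin 4),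
      (∀ i : ℕ, 8 ≤ i → 2 * ((i : ℝ) + 1) ≤ l1dist a z → ∀ m : Fin 4, (m = k + 1 ∨ m = k + 3) →
        ∀ f ∈ flatHalfBox m (runPt (faceAt a j₁) k i) (i / 8) (i / 8), ∀ j : Fin 4, f + cornerOff j ∈ Λ) ∧
      (∀ n : ℕ, 2 * (n : ℝ) + 1 ≤ l1dist a z → l1norm (plaqCentre (runPt (faceAt a j₁) k n) - z) ≤ l1dist a z - n) := by
  -- the dominant axis
  rcases le_total |(a 1 : ℝ) - z.im| |(a 0 : ℝ) - z.re| with hdom | hdom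
  · /- `x` dominant: run along `x`, direction `0` (towards larger `x`) iff `a 0 < z.re` -/
    set c₀ : Site 2 := ![endRunX (a 0) z.re 0, endRunY (a 1) z.im] with hc₀
    obtain ⟨j₁, hj₁⟩ : ∃ j₁ : Fin 4, c₀ = faceAt a j₁ := by
      refine exists_faceAt_of_offsets a c₀ ?_ ?_
      · simp only [hc₀, Matrix.cons_val_zero, endRunX]
        split_ifs <;> simp [sub_eq_add_neg]
      · simp only [hc₀, Matrix.cons_val_one, Matrix.cons_val_zero, endRunY]
        split_ifs <;> simp [sub_eq_add_neg]
    set k : Fin 4 := if (a 0 : ℝ) < z.re then 0 else 2 with hk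
    have hrun : ∀ n : ℤ, runPt c₀ k n 0 = endRunX (a 0) z.re n ∧ runPt c₀ k n 1 = endRunY (a 1) z.im := by
      intro n
      simp only [runPt_apply, hc₀, hk, Matrix.cons_val_zero, Matrix.cons_val_one, endRunX]
      split_ifs <;> simp [sub_eq_add_neg]
    have hdist : l1dist a z = |(a 0 : ℝ) - z.re| + |(a 1 : ℝ) - z.im| := rfl
    have hDx : l1dist a z ≤ 2 * |(a 0 : ℝ) - z.re| := by rw [hdist]; linarith
    refine ⟨k, j₁, ?_, ?_⟩
    · intro i hi8 hi m hm f hf j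
      rw [← hj₁] at hf
      have hi' : (i : ℝ) + 1 ≤ |(a 0 : ℝ) - z.re| := by linarith
      have hbox := flatHalfBox_subset_sqBox m (runPt c₀ k i) (i / 8) (i / 8) hf
      rw [mem_sqBox, (hrun i).1, (hrun i).2, abs_le, abs_le] at hbox
      have hr : 2 * (i / 8 + i / 8) + 2 ≤ i := by omega
      apply mem_of_l1dist_lt hmin
      rw [hdist]
      have hc : ∀ l : Fin 2, ((f + cornerOff j) l : ℝ) = ((f l + cornerOff j l : ℤ) : ℝ) := fun l => by simp [Pi.add_apply]
      unfold l1dist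
      rw [hc 0, hc 1]
      have h01 : (cornerOff j 0 = 0 ∨ cornerOff j 0 = 1) ∧ (cornerOff j 1 = 0 ∨ cornerOff j 1 = 1) := by
        fin_cases j <;> simp
      refine endRun_core hi' hr ⟨?_, ?_⟩ ⟨?_, ?_⟩
      · have := hbox.1.1; push_cast; rcases h01.1 with h | h <;> rw [h] <;> omega
      · have := hbox.1.2; push_cast; rcases h01.1 with h | h <;> rw [h] <;> omega
      · have := hbox.2.1; rcases h01.2 with h | h <;> rw [h] <;> omega
      · have := hbox.2.2; rcases h01.2 with h | h <;> rw [h] <;> omega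
    · intro n hn
      rw [← hj₁]
      have hn' : (n : ℝ) + 1 / 2 ≤ |(a 0 : ℝ) - z.re| := by linarith
      simp only [l1norm, plaqCentre, Complex.sub_re, Complex.sub_im, (hrun n).1, (hrun n).2]
      rw [hdist]
      have hx : |((endRunX (a 0) z.re n : ℤ) : ℝ) + 1 / 2 - z.re| ≤ |(a 0 : ℝ) - z.re| - n - 1 / 2 := by
        unfold endRunX
        split_ifs with hlt
        · rw [abs_of_neg (sub_neg.2 hlt)] at hn' ⊢
          push_cast
          rw [abs_le]; constructor <;> linarith
        · push Not at hlt
          rw [abs_of_nonneg (sub_nonneg.2 hlt)] at hn' ⊢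
          push_cast
          rw [abs_le]; constructor <;> linarith
      have hy : |((endRunY (a 1) z.im : ℤ) : ℝ) + 1 / 2 - z.im| ≤ |(a 1 : ℝ) - z.im| + 1 / 2 := by
        unfold endRunY
        split_ifs with hle
        · rw [abs_of_nonpos (sub_nonpos.2 hle)]
          rw [abs_le]; constructor <;> linarith
        · push Not at hle
          rw [abs_of_pos (sub_pos.2 hle)]
          push_cast
          rw [abs_le]; constructor <;> linarith
      linarith
  · /- `y` dominant: run along `y`, direction `1` (towards larger `y`) iff `a 1 < z.im` -/
    set c₀ : Site 2 := ![endRunY (a 0) z.re, endRunX (a 1) z.im 0] with hc₀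
    obtain ⟨j₁, hj₁⟩ : ∃ j₁ : Fin 4, c₀ = faceAt a j₁ := by
      refine exists_faceAt_of_offsets a c₀ ?_ ?_
      · simp only [hc₀, Matrix.cons_val_zero, endRunY]
        split_ifs <;> simp [sub_eq_add_neg]
      · simp only [hc₀, Matrix.cons_val_one, Matrix.cons_val_zero, endRunX]
        split_ifs <;> simp [sub_eq_add_neg]
    set k : Fin 4 := if (a 1 : ℝ) < z.im then 1 else 3 with hk
    have hrun : ∀ n : ℤ, runPt c₀ k n 0 = endRunY (a 0) z.re ∧ runPt c₀ k n 1 = endRunX (a 1) z.im n := by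
      intro n
      simp only [runPt_apply, hc₀, hk, Matrix.cons_val_zero, Matrix.cons_val_one, endRunX]
      split_ifs <;> simp [sub_eq_add_neg]
    have hdist : l1dist a z = |(a 0 : ℝ) - z.re| + |(a 1 : ℝ) - z.im| := rfl
    have hDy : l1dist a z ≤ 2 * |(a 1 : ℝ) - z.im| := by rw [hdist]; linarith
    refine ⟨k, j₁, ?_, ?_⟩
    · intro i hi8 hi m hm f hf j
      rw [← hj₁] at hf
      have hi' : (i : ℝ) + 1 ≤ |(a 1 : ℝ) - z.im| := by linarith
      have hbox := flatHalfBox_subset_sqBox m (runPt c₀ k i) (i / 8) (i / 8) hf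
      rw [mem_sqBox, (hrun i).1, (hrun i).2, abs_le, abs_le] at hbox
      have hr : 2 * (i / 8 + i / 8) + 2 ≤ i := by omega
      apply mem_of_l1dist_lt hmin
      rw [hdist]
      have hc : ∀ l : Fin 2, ((f + cornerOff j) l : ℝ) = ((f l + cornerOff j l : ℤ) : ℝ) := fun l => by simp [Pi.add_apply]
      unfold l1dist
      rw [hc 0, hc 1]
      have h01 : (cornerOff j 0 = 0 ∨ cornerOff j 0 = 1) ∧ (cornerOff j 1 = 0 ∨ cornerOff j 1 = 1) := by
        fin_cases j <;> simp
      have key := endRun_core (ay := a 0) (zx := z.im) (zy := z.re) (v₀ := f 1 + cornerOff j 1) (v₁ := f 0 + cornerOff j 0) hi' hr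
        ⟨?_, ?_⟩ ⟨?_, ?_⟩
      · linarith
      · have := hbox.2.1; rcases h01.2 with h | h <;> rw [h] <;> omega
      · have := hbox.2.2; rcases h01.2 with h | h <;> rw [h] <;> omega
      · have := hbox.1.1; rcases h01.1 with h | h <;> rw [h] <;> omega
      · have := hbox.1.2; rcases h01.1 with h | h <;> rw [h] <;> omega
    · intro n hn
      rw [← hj₁]
      have hn' : (n : ℝ) + 1 / 2 ≤ |(a 1 : ℝ) - z.im| := by linarith
      simp only [l1norm, plaqCentre, Complex.sub_re, Complex.sub_im, (hrun n).1, (hrun n).2]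
      rw [hdist]
      have hx : |((endRunX (a 1) z.im n : ℤ) : ℝ) + 1 / 2 - z.im| ≤ |(a 1 : ℝ) - z.im| - n - 1 / 2 := by
        unfold endRunX
        split_ifs with hlt
        · rw [abs_of_neg (sub_neg.2 hlt)] at hn' ⊢
          push_cast
          rw [abs_le]; constructor <;> linarith
        · push Not at hlt
          rw [abs_of_nonneg (sub_nonneg.2 hlt)] at hn' ⊢
          push_cast
          rw [abs_le]; constructor <;> linarith
      have hy : |((endRunY (a 0) z.re : ℤ) : ℝ) + 1 / 2 - z.re| ≤ |(a 0 : ℝ) - z.re| + 1 / 2 := by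
        unfold endRunY
        split_ifs with hle
        · rw [abs_of_nonpos (sub_nonpos.2 hle)]
          rw [abs_le]; constructor <;> linarith
        · push Not at hle
          rw [abs_of_pos (sub_pos.2 hle)]
          push_cast
          rw [abs_le]; constructor <;> linarith
      linarith

/-- The form consumed by `hconeE` of `kc_sign_condition_ineq`: plaquettes of the lateral
half-boxes touch `Λ` across every side. [folklore] -/
theorem exists_endRun_sideTouch (Λ : Finset (Site 2)) (z : ℂ) {a : Site 2}
    (hmin : ∀ a' : Site 2, a' ∉ Λ → l1dist a z ≤ l1dist a' z) :
    ∃ (k j₁ : Fin 4),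
      (∀ i : ℕ, 8 ≤ i → 2 * ((i : ℝ) + 1) ≤ l1dist a z → ∀ m : Fin 4, (m = k + 1 ∨ m = k + 3) →
        ∀ f ∈ flatHalfBox m (runPt (faceAt a j₁) k i) (i / 8) (i / 8), ∀ j : Fin 4, SideTouch Λ f j) ∧
      (∀ n : ℕ, 2 * (n : ℝ) + 1 ≤ l1dist a z → l1norm (plaqCentre (runPt (faceAt a j₁) k n) - z) ≤ l1dist a z - n) := by
  obtain ⟨k, j₁, h1, h2⟩ := exists_endRun Λ z hmin
  exact ⟨k, j₁, fun i hi8 hi m hm f hf j => sideTouch_of_corners_mem (h1 i hi8 hi m hm f hf) j, h2⟩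

end Literature.Probability.LatticeModels
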